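import Mathlib
import Literature.RingTheory.PowerSeries.LaurentSeriesDerivation

/-!
# Crux `InverseLandauRationalCurves`, line `Sketch` — kernel helpers, III: the period module
`K′ ⊗_{k(ϖ)} k((ϖ))`

Helpers for the lead's stub `stub_kernel` (item stmt-KontsevichZagierPeriods-13872). The period
functional of the line takes values in `𝕃 := K′ ⊗_{k(ϖ)} k((ϖ))` ("formal `ϖ`-expansions with
coefficients algebraic over `k(ϖ)`", without choosing any embedding of `K′` into a Puiseux field).

* `exists_tensorDerivation` — the derivation `D ⊗ 1 + 1 ⊗ d/dϖ` of `𝕃` is well defined (the two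
  summands are not separately balanced; their sum is).
* `exists_traceFunctional` — `Tr ⊗ id : 𝕃 → k((ϖ))`.
* `eq_zero_of_tmul_one_eq_zero` — `x ↦ x ⊗ 1` is injective.
* `laurent_coeff_mul_eq_zero`, `laurent_coeff_sum_eq_zero` — bookkeeping of "positive `ϖ`-order".
-/

noncomputable section

open Polynomial TensorProduct
open scoped LaurentSeries RatFunc WithZero

namespace Summit.KontsevichZagierPeriods.InverseLandau.RationalCurves

section Tensor

variable {k : Type*} [Field k] {K' : Type*} [Field K'] [Algebra k K'] [Algebra (RatFunc k) K']

/-- **The derivation of the period module.** For a `k`-derivation `D` of `K′` restricting to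
`d/dϖ` on `k(ϖ)` (i.e. `D ∘ ι = ι ∘ D₀` where `D₀` is `d/dϖ`, itself compatible with
`LaurentSeries.derivative` under `k(ϖ) ↪ k((ϖ))`), the map `x ⊗ y ↦ Dx ⊗ y + x ⊗ y′` is a
well-defined additive endomorphism of `K′ ⊗_{k(ϖ)} k((ϖ))`. -/
theorem exists_tensorDerivation (D₀ : Derivation k (RatFunc k) (RatFunc k))
    (hD₀L : ∀ x : RatFunc k, ((D₀ x : RatFunc k) : k⸨X⸩) = LaurentSeries.derivative k (x : k⸨X⸩))
    (D : Derivation k K' K')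
    (hD : ∀ x : RatFunc k, D (algebraMap (RatFunc k) K' x) = algebraMap (RatFunc k) K' (D₀ x)) :
    ∃ DL : K' ⊗[RatFunc k] k⸨X⸩ →+ K' ⊗[RatFunc k] k⸨X⸩, ∀ (x : K') (y : k⸨X⸩),
      DL (x ⊗ₜ y) = D x ⊗ₜ y + x ⊗ₜ LaurentSeries.derivative k y := by
  set der := LaurentSeries.derivative k (V := k) with hder
  let f : K' →+ k⸨X⸩ →+ K' ⊗[RatFunc k] k⸨X⸩ :=
    { toFun := fun x =>
        { toFun := fun y => D x ⊗ₜ y + x ⊗ₜ der y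
          map_zero' := by simp only [tmul_zero, map_zero, add_zero]
          map_add' := fun y₁ y₂ => by
            simp only [tmul_add, map_add]
            abel }
      map_zero' := by
        ext y
        simp only [map_zero, zero_tmul, add_zero, AddMonoidHom.coe_mk, ZeroHom.coe_mk,
          AddMonoidHom.zero_apply]
      map_add' := fun x₁ x₂ => by
        ext y
        simp only [map_add, add_tmul, AddMonoidHom.coe_mk, ZeroHom.coe_mk, AddMonoidHom.add_apply]
        abel }
  have hf : ∀ x y, f x y = D x ⊗ₜ y + x ⊗ₜ der y := fun _ _ => rfl
  refine ⟨TensorProduct.liftAddHom f fun r x y => ?_, fun x y => by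
    rw [TensorProduct.liftAddHom_tmul]; rfl⟩
  rw [hf, hf]
  -- `D (r • x) = r • D x + (D₀ r) • x` and `(r • y)′ = r • y′ + (D₀ r) • y`
  have h1 : D (r • x) = r • D x + (D₀ r) • x := by
    rw [Algebra.smul_def, Derivation.leibniz, hD, smul_eq_mul, smul_eq_mul, Algebra.smul_def,
      Algebra.smul_def]
    ring
  have h2 : der (r • y) = r • der y + (D₀ r) • y := by
    rw [Algebra.smul_def, Algebra.smul_def, Algebra.smul_def, hder,
      Literature.RingTheory.PowerSeries.derivative_mul]
    change der (r : k⸨X⸩) * y + (r : k⸨X⸩) * der y = (r : k⸨X⸩) * der y + ((D₀ r : RatFunc k) : k⸨X⸩) * y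
    rw [hD₀L r, add_comm]
  rw [h1, h2, add_tmul, tmul_add, smul_tmul, smul_tmul, smul_tmul]
  abel

omit [Algebra k K'] in
/-- **The trace functional** `Tr ⊗ id : K′ ⊗_{k(ϖ)} k((ϖ)) → k((ϖ))`. -/
theorem exists_traceFunctional :
    ∃ τ : K' ⊗[RatFunc k] k⸨X⸩ →ₗ[RatFunc k] k⸨X⸩, ∀ (x : K') (y : k⸨X⸩),
      τ (x ⊗ₜ y) = Algebra.trace (RatFunc k) K' x • y :=
  ⟨TensorProduct.lift ((LinearMap.lsmul (RatFunc k) k⸨X⸩).comp (Algebra.trace (RatFunc k) K')),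
    fun x y => by rw [TensorProduct.lift.tmul]; rfl⟩

omit [Algebra k K'] in
/-- **`x ↦ x ⊗ 1` is injective** (`k((ϖ))` is a vector space over the field `k(ϖ)` in which `1`
spans a line, so `x ⊗ 1 ↦ x` is induced by a linear retraction of `k(ϖ) → k((ϖ))`). -/
theorem eq_zero_of_tmul_one_eq_zero (x : K') (hx : x ⊗ₜ[RatFunc k] (1 : k⸨X⸩) = 0) : x = 0 := by
  set ι : RatFunc k →ₗ[RatFunc k] k⸨X⸩ := Algebra.linearMap (RatFunc k) k⸨X⸩ with hι
  have hinj : LinearMap.ker ι = ⊥ :=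
    LinearMap.ker_eq_bot.2 (algebraMap (RatFunc k) k⸨X⸩).injective
  obtain ⟨ψ, hψ⟩ := LinearMap.exists_leftInverse_of_injective ι hinj
  have hψ1 : ψ 1 = 1 := by
    have := congrArg (fun g => g 1) hψ
    simpa only [LinearMap.comp_apply, LinearMap.id_apply, hι, Algebra.linearMap_apply, map_one]
      using this
  have h := congrArg (fun z => TensorProduct.rid (RatFunc k) K' (LinearMap.lTensor K' ψ z)) hx
  simp only [LinearMap.lTensor_tmul, hψ1, TensorProduct.rid_tmul, one_smul, map_zero] at h
  exact h

omit [Algebra k K'] [Algebra (RatFunc k) K'] in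
/-- Positive `ϖ`-order is preserved under multiplication by a power series: if all coefficients of
index `≤ 0` of `a` and all coefficients of negative index of `b` vanish, then all coefficients of
index `≤ 0` of `a·b` vanish. -/
theorem laurent_coeff_mul_eq_zero (a b : k⸨X⸩) (ha : ∀ n : ℤ, n ≤ 0 → a.coeff n = 0)
    (hb : ∀ n : ℤ, n < 0 → b.coeff n = 0) {n : ℤ} (hn : n ≤ 0) : (a * b).coeff n = 0 := by
  have hva : Valued.v a ≤ WithZero.exp (-(1 : ℤ)) :=
    (LaurentSeries.valuation_le_iff_coeff_lt_eq_zero k).2 fun m hm => ha m (by omega)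
  have hvb : Valued.v b ≤ WithZero.exp (-(0 : ℤ)) :=
    (LaurentSeries.valuation_le_iff_coeff_lt_eq_zero k).2 fun m hm => hb m (by omega)
  have hvab : Valued.v (a * b) ≤ WithZero.exp (-(1 : ℤ)) := by
    rw [Valuation.map_mul]
    calc Valued.v a * Valued.v b ≤ WithZero.exp (-(1 : ℤ)) * WithZero.exp (-(0 : ℤ)) :=
          mul_le_mul' hva hvb
      _ = WithZero.exp (-(1 : ℤ)) := by rw [← WithZero.exp_add]; norm_num
  exact LaurentSeries.coeff_zero_of_lt_valuation k (D := 1) hvab (by omega)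

omit [Algebra k K'] [Algebra (RatFunc k) K'] in
/-- Positive `ϖ`-order is preserved under finite sums. -/
theorem laurent_coeff_sum_eq_zero {ι : Type*} (s : Finset ι) (f : ι → k⸨X⸩) (n : ℤ)
    (h : ∀ i ∈ s, (f i).coeff n = 0) : (∑ i ∈ s, f i).coeff n = 0 := by
  rw [HahnSeries.coeff_sum]
  exact Finset.sum_eq_zero h

omit [Algebra k K'] [Algebra (RatFunc k) K'] in
/-- A power series has no coefficients of negative index. -/
theorem laurent_coeff_coe_powerSeries_neg (f : PowerSeries k) {n : ℤ} (hn : n < 0) :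
    ((f : k⸨X⸩) : k⸨X⸩).coeff n = 0 := by
  have hv : Valued.v ((f : k⸨X⸩) : k⸨X⸩) ≤ (1 : ℤᵐ⁰) :=
    (LaurentSeries.val_le_one_iff_eq_coe k _).2 ⟨f, rfl⟩
  rw [← WithZero.exp_zero, show (0 : ℤ) = -0 by norm_num] at hv
  exact LaurentSeries.coeff_zero_of_lt_valuation k (D := 0) hv hn

end Tensor

/-- **Registered sub-goal `kernel_tensor_pack`** (packaging for the gate): the derivation
`D ⊗ 1 + 1 ⊗ d/dϖ` of the period module `K′ ⊗_{k(ϖ)} k((ϖ))` exists. -/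
theorem kernel_tensor_pack : ∀ {k : Type*} [Field k] {K' : Type*} [Field K'] [Algebra k K']
    [Algebra (RatFunc k) K'] (D₀ : Derivation k (RatFunc k) (RatFunc k))
    (_ : ∀ x : RatFunc k, ((D₀ x : RatFunc k) : LaurentSeries k) =
      LaurentSeries.derivative k (x : LaurentSeries k))
    (D : Derivation k K' K')
    (_ : ∀ x : RatFunc k, D (algebraMap (RatFunc k) K' x) = algebraMap (RatFunc k) K' (D₀ x)),
    ∃ DL : TensorProduct (RatFunc k) K' (LaurentSeries k) →+ TensorProduct (RatFunc k) K' (LaurentSeries k),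
      ∀ (x : K') (y : LaurentSeries k),
        DL (TensorProduct.tmul (RatFunc k) x y) =
          TensorProduct.tmul (RatFunc k) (D x) y +
            TensorProduct.tmul (RatFunc k) x (LaurentSeries.derivative k y) :=
  fun D₀ hD₀L D hD => exists_tensorDerivation D₀ hD₀L D hD

end Summit.KontsevichZagierPeriods.InverseLandau.RationalCurves

end
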